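import Literature.Probability.LatticeModels.EffectiveResistance
import Literature.Probability.LatticeModels.RandomCluster
import Literature.Probability.LatticeModels.FermionicObservable
import Literature.Probability.Percolation.Crossings
import HarnessLib

/-!
# Crossing probabilities in topological rectangles for the critical FK-Ising model (named fact)

Topic `Literature/Probability/LatticeModels` (family `crit-ising`). D. Chelkak, H. Duminil-Copin,
C. Hongler, *Crossing probabilities in topological rectangles for the critical planar FK-Ising model*,
Electron. J. Probab. 21 (2016), paper no. 5 (arXiv:1312.7785):

* §2.1 (discrete domains): "a finite planar graph `G ⊂ ℤ²` will be identified with the set of its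
  vertices … we always assume that `G` is connected and simply connected meaning that all edges
  surrounded by a cycle from `𝓔(G)` also belong to `𝓔(G)`. We call such graphs discrete domains. …
  `∂Ω := {x ∈ Ω : ∃ y ∈ ℤ² : x ∼ y and xy ∉ 𝓔(Ω)}`. As `Ω` is simply connected, there exists a natural
  cyclic order on `∂Ω`. … We call a discrete domain `Ω` with four marked vertices `a,b,c,d ∈ ∂Ω` listed
  counterclockwise a topological rectangle"; §3.3: `ℓ_Ω[(ab),(cd)]` "denote[s] the resistance of the
  electrical network `Ω` (with unit conductances on all edges) between `(ab)` and `(cd)`".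
* **Theorem 1.1.** "For each `L > 0` there exists `η = η(L) ∈ (0,1)` such that, for any topological
  rectangle `(Ω,a,b,c,d)` and any boundary conditions `ξ`, the following is fulfilled:
  (i) if `ℓ_Ω[(ab),(cd)] ≤ L`, then `φ^ξ_Ω[(ab) ↔ (cd)] ≥ η`;
  (ii) if `ℓ_Ω[(ab),(cd)] ≥ L⁻¹`, then `φ^ξ_Ω[(ab) ↔ (cd)] ≤ 1 - η`."
* **Remark 2.2.** "The free and wired boundary conditions are extremal for stochastic domination …
  Hence to get a lower (respectively an upper) bound on crossing probabilities that is uniform with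
  respect to `ξ`, it is enough to get such a bound for `ξ = ∅` (respectively `ξ = ∂Ω`)."

Here (`DiscreteRect`): a discrete domain is given by its finite set `E` of lattice edges; the external
boundary darts `(x, k)` (`x` an endpoint of an edge of `E`, the lattice edge from `x` in direction `k`
missing from `E` — CDH16's `𝓔_ext(Ω)`, §3) carry the boundary-tracing successor `DiscreteRect.succ`
(walk along `∂Ω` keeping the missing edges on one fixed side), and `DiscreteRect.IsRect E d₀ n` says that
the successor orbit of the dart `d₀` runs through ALL external darts exactly once with period
`n 0 + n 1 + n 2 + n 3` (one boundary cycle: `Ω` is connected and simply connected) and is cut into four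
consecutive nonempty arcs of `n 0, …, n 3` darts; `DiscreteRect.arcVerts E d₀ n j` is the set of vertices
carrying the darts of the `j`-th arc (the marked vertices `a, b, c, d` being the extreme vertices of the
arcs `0` and `2`, so that `(ab) = arcVerts 0`, `(cd) = arcVerts 2` as vertex sets). The theorem is stated
(`fkIsing_topologicalRectangle_crossingBounds`) for H21's random-cluster measure `rcMeasure` (explicit
finite Gibbs measure `φ^B_{G,p,q}`, `RandomCluster.lean`) of the graph `⟨E⟩` on its vertex set at
`p = p_c = √2/(1+√2)` (`criticalFKIsingParam`), `q = 2`, free (`B = ∅`) for (i) and wired on all boundary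
vertices (`B = bdVerts`) for (ii) (Remark 2.2), for the open crossing event `openCrossing` of
`Percolation/Crossings.lean`, and for the discrete extremal length = effective resistance with unit
conductances `effectiveResistance ⟨E⟩ 1 (ab) (cd)` of `EffectiveResistance.lean` (Duffin's theorem
`extremalLength_eq_effectiveResistance` there identifies it with the extremal-length form (3.7) of CDH16).
The orientation of the boundary cycle is immaterial (a reflection of `ℤ²` exchanges the two
orientations and preserves the model), so no counterclockwise condition is imposed.

Mathlib anchors: `Sym2`, `SimpleGraph.fromEdgeSet`, `SimpleGraph.comap`, `Nat.iterate`. Mathlib has no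
random-cluster model, no discrete domains of `ℤ²` and no crossing estimates.

## References
* D. Chelkak, H. Duminil-Copin, C. Hongler, Electron. J. Probab. 21 (2016), no. 5, Thm. 1.1, Rem. 2.2,
  §2.1, §3.3. [ChelkakDuminilCopinHongler2016]
* D. Chelkak, *Robust discrete complex analysis: a toolbox*, Ann. Probab. 44 (2016), §6 (discrete
  extremal length). [Chelkak2016]
* R. J. Duffin, *The extremal length of a network*, J. Math. Anal. Appl. 5 (1962). [Duffin1962]
-/

noncomputable section

open MeasureTheory
open Literature.Probability.Percolation

namespace Literature.Probability.LatticeModels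

namespace DiscreteRect

/-- The four lattice directions of `ℤ²` in cyclic order: `e₀, e₁, -e₀, -e₁`. [folklore] -/
def dir (k : Fin 4) : Site 2 :=
  ![Pi.single 0 1, Pi.single 1 1, -Pi.single 0 1, -Pi.single 1 1] k

/-- The two endpoints of an unordered pair, as a finset. [folklore] -/
def endpts (e : Sym2 (Site 2)) : Finset (Site 2) :=
  Sym2.lift ⟨fun x y => ({x, y} : Finset (Site 2)), fun x y => Finset.pair_comm x y⟩ e

/-- The vertex set of the discrete domain with edge set `E`: the endpoints of its edges (CDH16 §2.1:
"a finite planar graph `G ⊂ ℤ²` will be identified with the set of its vertices").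
[cite: ChelkakDuminilCopinHongler2016, §2.1] -/
def verts (E : Finset (Sym2 (Site 2))) : Finset (Site 2) :=
  E.biUnion endpts

/-- **External boundary darts** `(x, k)` of the discrete domain `E`: `x` is a vertex of `E` and the
lattice edge from `x` in direction `k` is not an edge of `E` (CDH16 §3:
`𝓔_ext(Ω) := {xy : x ∈ ∂Ω, y ∈ ℤ², x ∼ y and xy ∉ 𝓔(Ω)}`; the vertices carrying an external dart form
the vertex boundary `∂Ω` of §2.1). [cite: ChelkakDuminilCopinHongler2016, §2.1 and §3] -/
def IsExtDart (E : Finset (Sym2 (Site 2))) (d : Site 2 × Fin 4) : Prop :=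
  d.1 ∈ verts E ∧ s(d.1, d.1 + dir d.2) ∉ E

/-- The vertex boundary `∂Ω = {x ∈ Ω : ∃ y ∼ x, xy ∉ 𝓔(Ω)}` of the discrete domain `E`.
[cite: ChelkakDuminilCopinHongler2016, §2.1] -/
def bdVerts (E : Finset (Sym2 (Site 2))) : Set (Site 2) :=
  {x | ∃ k : Fin 4, IsExtDart E (x, k)}

/-- **Boundary tracing**: the successor of the external dart `(x, k)` along the boundary of the
discrete domain `E`, walking with the missing edges kept on one fixed side (turn at `x` to the next
missing direction, or advance along the existing edge and turn towards the missing side at most three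
times; in the last case the walk has gone round the three other sides of the unit square on the
missing edge `x, x + dir k` and the successor is the reversed dart `(x + dir k, k + 2)`). This is the
"natural cyclic order on `∂Ω`" of CDH16 §2.1, made explicit on external darts.
[cite: ChelkakDuminilCopinHongler2016, §2.1] -/
def succ (E : Finset (Sym2 (Site 2))) (d : Site 2 × Fin 4) : Site 2 × Fin 4 :=
  let x := d.1
  let k := d.2
  if s(x, x + dir (k + 1)) ∉ E then (x, k + 1)
  else
    let y := x + dir (k + 1)
    if s(y, y + dir k) ∉ E then (y, k)
    else
      let y' := y + dir k
      if s(y', y' + dir (k - 1)) ∉ E then (y', k - 1)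
      else (y' + dir (k - 1), k - 2)

/-- Offsets of the four arcs along the boundary cycle: arc `j` occupies the positions
`[lo n j, lo n j + n j)`. [folklore] -/
def lo (n : Fin 4 → ℕ) : Fin 4 → ℕ :=
  ![0, n 0, n 0 + n 1, n 0 + n 1 + n 2]

/-- **Discrete topological rectangle** `(Ω; a, b, c, d)` presented by its edge set `E ⊆ 𝓔(ℤ²)`, a
first external dart `d₀` and the numbers `n 0, …, n 3 ≥ 1` of external darts of its four boundary arcs:
the boundary-tracing orbit of `d₀` has period `N = n 0 + n 1 + n 2 + n 3`, is injective on `[0, N)` and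
runs through every external dart — one boundary cycle, i.e. `Ω` is connected and simply connected
(CDH16 §2.1) — and is cut into the four consecutive arcs of darts at positions `[lo n j, lo n j + n j)`.
[cite: ChelkakDuminilCopinHongler2016, §2.1] -/
structure IsRect (E : Finset (Sym2 (Site 2))) (d₀ : Site 2 × Fin 4) (n : Fin 4 → ℕ) : Prop where
  subset_edgeSet : ∀ e ∈ E, e ∈ (zdGraph 2).edgeSet
  isExtDart : IsExtDart E d₀
  pos : ∀ j, 0 < n j
  periodic : (succ E)^[n 0 + n 1 + n 2 + n 3] d₀ = d₀
  injOn : ∀ i j, i < n 0 + n 1 + n 2 + n 3 → j < n 0 + n 1 + n 2 + n 3 →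
    (succ E)^[i] d₀ = (succ E)^[j] d₀ → i = j
  cover : ∀ d, IsExtDart E d → ∃ i < n 0 + n 1 + n 2 + n 3, (succ E)^[i] d₀ = d

/-- The vertices of the `j`-th boundary arc of the rectangle `(E, d₀, n)`: those carrying an external
dart at a position in `[lo n j, lo n j + n j)` of the boundary cycle (CDH16's arcs `(ab), (bc), (cd),
(da)` as vertex sets, the marked vertices being the extreme vertices of the arcs `0` and `2`).
[cite: ChelkakDuminilCopinHongler2016, §2.1] -/
def arcVerts (E : Finset (Sym2 (Site 2))) (d₀ : Site 2 × Fin 4) (n : Fin 4 → ℕ) (j : Fin 4) :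
    Set (Site 2) :=
  {x | ∃ i, lo n j ≤ i ∧ i < lo n j + n j ∧ ((succ E)^[i] d₀).1 = x}

/-- The graph `⟨E⟩` of the discrete domain on its (finite) vertex type. [cite: ChelkakDuminilCopinHongler2016, §2.1] -/
def graph (E : Finset (Sym2 (Site 2))) : SimpleGraph ↥((verts E : Finset (Site 2)) : Set (Site 2)) :=
  (SimpleGraph.fromEdgeSet (↑E : Set (Sym2 (Site 2)))).comap Subtype.val

open scoped Classical in
/-- The critical FK-Ising (random-cluster, `q = 2`, `p = p_c = √2/(1+√2)`) measure of the discrete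
domain `E`, wired on `B` (`B = ∅`: free; `B = ∂Ω`: wired boundary conditions): H21's `rcMeasure` of
`⟨E⟩` on its vertex type (CDH16 §2.2, §2.4). [cite: ChelkakDuminilCopinHongler2016, §2.2] -/
def fkMeasure (E : Finset (Sym2 (Site 2))) (B : Set ↥((verts E : Finset (Site 2)) : Set (Site 2))) :
    Measure (BondConfig ↥((verts E : Finset (Site 2)) : Set (Site 2))) :=
  rcMeasure (graph E) criticalFKIsingParam 2 B

end DiscreteRect

/-- **Crossing probabilities in topological rectangles for the critical FK-Ising model**
(Chelkak–Duminil-Copin–Hongler 2016, Thm. 1.1 with Remark 2.2): for each `L > 0` there is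
`η = η(L) ∈ (0, 1)` such that for every discrete topological rectangle `(Ω; a, b, c, d)` — here
`DiscreteRect.IsRect E d₀ n` with arcs `(ab) = arcVerts 0`, `(cd) = arcVerts 2` — writing
`ℓ = ℓ_Ω[(ab),(cd)]` for the effective resistance of the network `Ω` with unit conductances between
`(ab)` and `(cd)` (`effectiveResistance`, `= ` the discrete extremal length by Duffin's theorem):
(i) if `ℓ ≤ L` then the FREE critical FK-Ising measure of `Ω` gives the event "`(ab)` and `(cd)` are
connected by a path of open edges" probability `≥ η`; (ii) if `ℓ ≥ L⁻¹` then the measure with ALL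
boundary vertices WIRED gives it probability `≤ 1 - η` (by Remark 2.2 these extremal boundary conditions
give the bounds for every `ξ`). Named fact (printed proof: discrete complex analysis — Smirnov's
fermionic observable, the Chelkak–Smirnov representation of alternating-boundary-condition crossing
probabilities, and the uniform toolbox estimates of Chelkak 2016 — CDH16 §4).
[cite: ChelkakDuminilCopinHongler2016, Theorem 1.1 and Remark 2.2] -/
def fkIsing_topologicalRectangle_crossingBounds : Prop :=
  ∀ L : ℝ, 0 < L → ∃ η : ℝ, 0 < η ∧ η < 1 ∧
    ∀ (E : Finset (Sym2 (Site 2))) (d₀ : Site 2 × Fin 4) (n : Fin 4 → ℕ), DiscreteRect.IsRect E d₀ n →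
      let A : Set (Site 2) := DiscreteRect.arcVerts E d₀ n 0
      let C : Set (Site 2) := DiscreteRect.arcVerts E d₀ n 2
      let ℓ : ENNReal := effectiveResistance (SimpleGraph.fromEdgeSet (↑E : Set (Sym2 (Site 2)))) 1 A C
      (ℓ ≤ ENNReal.ofReal L →
        η ≤ (DiscreteRect.fkMeasure E ∅).real
          (openCrossing Set.univ {x | x.1 ∈ A} {x | x.1 ∈ C})) ∧
      (ENNReal.ofReal L⁻¹ ≤ ℓ →
        (DiscreteRect.fkMeasure E {x | x.1 ∈ DiscreteRect.bdVerts E}).real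
          (openCrossing Set.univ {x | x.1 ∈ A} {x | x.1 ∈ C}) ≤ 1 - η)

end Literature.Probability.LatticeModels

end
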